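import Summits.QuantumFields.YangMills.Theorems.ColdStartUniversalityLatticeLangevinPointwiseMixingLoopStrings
import Summits.QuantumFields.YangMills.Theorems.ColdStartUniversalityLatticeLangevinLocalPoincare
import Summits.QuantumFields.YangMills.Theorems.ColdStartUniversalityUniformColdStartMixingFixedCutoffBlockLoopStringCesaro
import HarnessLib

/-!
# Route `ColdStartUniversality` (fixed-cut-off package, Bakry–Émery side): DYNAMIC CONCENTRATION OF BLOCK-AVERAGED LOOP STRINGS ABOUT THEIR
# GIBBS MEAN from EVERY deterministic start — the crux's observable shape `∏_k W̄_(B,k)`, with high probability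

Helper file (seat `ym-line-csu-p1`, g29; `--supports stmt-QuantumFields-24809`).  For the block loop strings `∏_k W̄_(B,k)` (`S = Σ_k(R_k+T_k)`):
* ★★ `wilson_solution_blockLoopString_variance_le_uniform` — dynamic variance along every SZZ solution from a deterministic start:
  `Var(∏_k W̄_(B,k)(U_t)) ≤ 16 S²/((1−12|β'|)·#B)` (local Poincaré along the dynamics `wilson_solution_variance_le_uniform` + `wilson_blockLoopString_carre_le`);
* ★★★ `wilson_solution_blockLoopString_sqDev_gibbsMean_le_uniform` — bias–variance with the every-start mean bound
  (`wilson_solution_blockLoopString_pointwise_mixing_uniform`):  `E[(∏W̄(U_t) − μ_(β')(∏W̄))²] ≤ 16S²/((1−12|β'|)#B) + (4√6·π·S·√(#S/#B)·e^(−(1−12|β'|)t))²`;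
* ★★★ `wilson_solution_blockLoopString_tail_gibbsMean_le_uniform` — Chebyshev tail about the Gibbs mean;
* ★★ `blockLoopString_tail_gibbsMean_fixedCutoff_window` — at the route's cut-offs with `6 < γε_K` (`#S = L_K³`).
For `B` = whole torus: after a volume-free lattice time `O(log(S/δ)/ρ)` the loop string is within `δ` of its Gibbs mean with probability
`≥ 1 − O(S²/(ρ L³ δ²))` along the COLD-start evolution.  THEOREMS ONLY, no definition, no sorry.  [cite: BakryGentilLedoux2014, Thm 4.7.2 (ii) +
Thm 3.3.18; ShenZhuZhu2022 §4 Cor. 4.7].  HONEST FRAMING: fixed cut-off, FIXED `|β'| < 1/12` (window-bound at the route's cut-offs); nothing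
`K`-uniform; `UniformColdStartMixing` (stmt-24809, aside) is NOT restated or weakened; the Yang–Mills mass gap is NOT proved.
-/

set_option autoImplicit false

noncomputable section

namespace Summit.QuantumFields.YangMills.Theorems.ColdStartUniversality

open MeasureTheory ProbabilityTheory Matrix Complex Finset Filter Set Metric
open scoped ComplexConjugate BigOperators Matrix NNReal ENNReal Topology
open Literature.Probability.Process Literature.MathematicalPhysics.QuantumFieldTheory
open Literature.MathematicalPhysics.QuantumFieldTheory.Balaban1983to89
open Literature.MathematicalPhysics.QuantumLattice (fundamentalRep fundamentalLatticeRep continuous_fundamentalRep fundamentalRep_apply)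

variable {L : ℕ} [NeZero L]

/-- ★★ **Dynamic variance of block loop strings along every SZZ solution, uniform in time and volume.**  At `|β'| < 1/12`, for every `L`,
nonempty block `B`, loop data (`S = Σ_k(R_k+T_k)`), every strong solution `U` from a deterministic start and every `t ≥ 0`:
`∫ (∏W̄_B(U_t) − E∏W̄_B(U_t))² dP ≤ 16 S²/((1−12|β'|)·#B)`. [cite: BakryGentilLedoux2014, Thm 4.7.2 (ii); ShenZhuZhu2022 §3 Lemma 3.1] -/
theorem wilson_solution_blockLoopString_variance_le_uniform (L : ℕ) [NeZero L] (β' : ℝ) (hβ : |β'| < 1 / 12)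
    (m : ℕ) (i j : Fin m → Fin 3) (R T : Fin m → ℕ) (B : Finset (Site 3 L)) (hB : B.Nonempty)
    (t : ℝ≥0) (x₀ : (GaugeConfig 3 L (Matrix.specialUnitaryGroup (Fin 2) ℂ)))
    (Ω : Type) [MeasurableSpace Ω] (P : Measure Ω) [IsProbabilityMeasure P]
    (W : ℝ≥0 → Ω → (Edge 3 L × NoiseIdx 2 → ℝ)) (hW : IsFlatBrownian W P)
    (U : ℝ≥0 → Ω → (GaugeConfig 3 L (Matrix.specialUnitaryGroup (Fin 2) ℂ))) (hU0 : ∀ ω, U 0 ω = x₀)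
    (hU : (latticeLangevinDynamics (fundamentalLatticeRep 2) β').IsSolution (fundamentalRep (Fin 2)) hW.natFiltration P W U) :
    ∫ ω, ((∏ k : Fin m, (((B.card : ℝ))⁻¹ * ∑ x ∈ B, wilsonLoop (fundamentalRep (Fin 2)) x (i k) (j k) (R k) (T k) (U t ω))) - (∫ ω', (∏ k : Fin m, (((B.card : ℝ))⁻¹ * ∑ x ∈ B, wilsonLoop (fundamentalRep (Fin 2)) x (i k) (j k) (R k) (T k) (U t ω'))) ∂P)) ^ 2 ∂P ≤ 16 * (∑ k : Fin m, ((R k : ℝ) + T k)) ^ 2 / ((1 - 12 * |β'|) * (B.card : ℝ)) := by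
  classical
  haveI := secondCountableTopology_su2
  haveI := borelSpace_config L
  have hρ : 0 < (1 - 12 * |β'|) := by linarith
  have hS : (0 : ℝ) < (B.card : ℝ) := by exact_mod_cast hB.card_pos
  set co : (GaugeConfig 3 L (Matrix.specialUnitaryGroup (Fin 2) ℂ)) → (Edge 3 L × Fin 2 × Fin 2 × Bool → ℝ) := (fun (V : GaugeConfig 3 L (Matrix.specialUnitaryGroup (Fin 2) ℂ)) (q : Edge 3 L × Fin (fundamentalLatticeRep 2).N × Fin (fundamentalLatticeRep 2).N × Bool) => (fun z : ℂ => if q.2.2.2 then z.im else z.re) ((fundamentalRep (Fin 2) (V q.1) : Matrix (Fin 2) (Fin 2) ℂ) q.2.1 q.2.2.1)) with hco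
  set F : Fin m → (Edge 3 L × Fin 2 × Fin 2 × Bool → ℝ) → ℝ := fun k => (fun y : (Edge 3 L × Fin 2 × Fin 2 × Bool → ℝ) => (2 * (B.card : ℝ))⁻¹ * ∑ x ∈ B, ((((((List.range (R k)).map (fun m : ℕ => ((Pi.single (i k) ((m : ℕ) : ZMod L) : Site 3 L), (i k), false)) ++ (List.range (T k)).map (fun m : ℕ => ((Pi.single (i k) (((R k) : ℕ) : ZMod L) : Site 3 L) + (Pi.single (j k) ((m : ℕ) : ZMod L) : Site 3 L), (j k), false)) ++ ((List.range (R k)).map (fun m : ℕ => ((Pi.single (j k) (((T k) : ℕ) : ZMod L) : Site 3 L) + (Pi.single (i k) ((m : ℕ) : ZMod L) : Site 3 L), (i k), true))).reverse ++ ((List.range (T k)).map (fun m : ℕ => ((Pi.single (j k) ((m : ℕ) : ZMod L) : Site 3 L), (j k), true))).reverse).map (fun q : Site 3 L × Fin 3 × Bool => ((x + q.1, q.2.1), q.2.2))).map (fun a : Edge 3 L × Bool => if a.2 then ((fun (ee : Edge 3 L) => Matrix.of fun (i' j' : Fin 2) => ((y (ee, i', j', false) : ℝ) : ℂ) + ((y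 (ee, i', j', true) : ℝ) : ℂ) * Complex.I) a.1)ᴴ else (fun (ee : Edge 3 L) => Matrix.of fun (i' j' : Fin 2) => ((y (ee, i', j', false) : ℝ) : ℂ) + ((y (ee, i', j', true) : ℝ) : ℂ) * Complex.I) a.1)).prod)).trace.re) with hFdef
  set fp : (Edge 3 L × Fin 2 × Fin 2 × Bool → ℝ) → ℝ := fun y => ∏ k : Fin m, F k y with hfp
  have hfpC : ContDiff ℝ 5 fp := contDiff_prod (fun k _ => contDiff_blockLoopAverage _ _ B)
  have hval : ∀ (k) (V : (GaugeConfig 3 L (Matrix.specialUnitaryGroup (Fin 2) ℂ))), F k (co V) = (((B.card : ℝ))⁻¹ * ∑ x ∈ B, wilsonLoop (fundamentalRep (Fin 2)) x (i k) (j k) (R k) (T k) V) :=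
    fun k V => blockLoopAverage_coords_eq V (i k) (j k) (R k) (T k) B hB
  have hvalP : ∀ V : (GaugeConfig 3 L (Matrix.specialUnitaryGroup (Fin 2) ℂ)), fp (co V) = (∏ k : Fin m, (((B.card : ℝ))⁻¹ * ∑ x ∈ B, wilsonLoop (fundamentalRep (Fin 2)) x (i k) (j k) (R k) (T k) V)) := fun V => Finset.prod_congr rfl fun k _ => hval k V
  -- the dynamic variance bound for `fp`
  have h := wilson_solution_variance_le_uniform L β' hβ hfpC t x₀ Ω P W hW U hU0 hU (wilson_blockLoopString_carre_le L β' m i j R T B hB)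
  -- bookkeeping `Y = fp (coords U_t)`
  obtain ⟨hcont, hbd⟩ := continuous_and_abs_le_one_blockLoopString m i j R T B hB
  have hmU : Measurable (U t) := (hU.adapted t).mono (hW.natFiltration.le t) le_rfl
  have hYm : AEStronglyMeasurable (fun ω => fp (co (U t ω))) P := by
    rw [show (fun ω => fp (co (U t ω))) = fun ω => (∏ k : Fin m, (((B.card : ℝ))⁻¹ * ∑ x ∈ B, wilsonLoop (fundamentalRep (Fin 2)) x (i k) (j k) (R k) (T k) (U t ω))) from funext fun ω => hvalP (U t ω)]
    exact (hcont.measurable.comp hmU).aestronglyMeasurable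
  have hYb : ∀ ω, |fp (co (U t ω))| ≤ 1 := fun ω => by rw [hvalP]; exact hbd _
  have iY : Integrable (fun ω => fp (co (U t ω))) P :=
    Integrable.of_bound hYm 1 (ae_of_all _ fun ω => by rw [Real.norm_eq_abs]; exact hYb ω)
  have iYY : Integrable (fun ω => fp (co (U t ω)) * fp (co (U t ω))) P := by
    refine Integrable.of_bound (hYm.mul hYm) 1 (ae_of_all _ fun ω => ?_)
    rw [Real.norm_eq_abs, abs_mul]
    calc |fp (co (U t ω))| * |fp (co (U t ω))| ≤ 1 * 1 := mul_le_mul (hYb ω) (hYb ω) (abs_nonneg _) zero_le_one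
      _ = 1 := one_mul 1
  set mY : ℝ := ∫ ω, fp (co (U t ω)) ∂P with hmY
  have hexpand : ∫ ω, (fp (co (U t ω)) - mY) ^ 2 ∂P = ∫ ω, fp (co (U t ω)) * fp (co (U t ω)) ∂P - mY ^ 2 := by
    have e1 : (fun ω => (fp (co (U t ω)) - mY) ^ 2) = fun ω => fp (co (U t ω)) * fp (co (U t ω)) - 2 * mY * fp (co (U t ω)) + mY ^ 2 := by
      funext ω; ring
    have i2 : Integrable (fun ω => 2 * mY * fp (co (U t ω))) P := iY.const_mul _
    have i12 : Integrable (fun ω => fp (co (U t ω)) * fp (co (U t ω)) - 2 * mY * fp (co (U t ω))) P := iYY.sub i2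
    rw [e1, integral_add i12 (integrable_const _), integral_sub iYY i2, integral_const_mul, integral_const]
    simp only [probReal_univ, smul_eq_mul, one_mul]
    rw [← hmY]; ring
  have hX : ∀ ω, (∏ k : Fin m, (((B.card : ℝ))⁻¹ * ∑ x ∈ B, wilsonLoop (fundamentalRep (Fin 2)) x (i k) (j k) (R k) (T k) (U t ω))) = fp (co (U t ω)) := fun ω => (hvalP (U t ω)).symm
  have hEX : (∫ ω', (∏ k : Fin m, (((B.card : ℝ))⁻¹ * ∑ x ∈ B, wilsonLoop (fundamentalRep (Fin 2)) x (i k) (j k) (R k) (T k) (U t ω'))) ∂P) = mY := by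
    rw [hmY]; exact integral_congr_ae (ae_of_all _ fun ω' => hX ω')
  have hsq : ∀ ω, ((∏ k : Fin m, (((B.card : ℝ))⁻¹ * ∑ x ∈ B, wilsonLoop (fundamentalRep (Fin 2)) x (i k) (j k) (R k) (T k) (U t ω))) - (∫ ω', (∏ k : Fin m, (((B.card : ℝ))⁻¹ * ∑ x ∈ B, wilsonLoop (fundamentalRep (Fin 2)) x (i k) (j k) (R k) (T k) (U t ω'))) ∂P)) ^ 2 = (fp (co (U t ω)) - mY) ^ 2 := fun ω => by rw [hEX, hX]
  rw [integral_congr_ae (ae_of_all _ fun ω => hsq ω), hexpand]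
  have hB0 : (B.card : ℝ) ≠ 0 := hS.ne'
  have hρ0 : (1 - 12 * |β'|) ≠ 0 := hρ.ne'
  have hconst : ∀ s : ℝ, (32 * s ^ 2 / (B.card : ℝ)) / (2 * (1 - 12 * |β'|)) = 16 * s ^ 2 / ((1 - 12 * |β'|) * (B.card : ℝ)) := fun s => by
    field_simp
    ring
  rw [← hconst]
  exact h

/-- ★★★ **Mean-square deviation of block loop strings from their GIBBS mean along every SZZ solution (bias–variance).**  At `|β'| < 1/12`, for
every `L`, nonempty `B`, loop data, every strong solution from a deterministic start and every `t ≥ 0`: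
`E[(∏W̄_B(U_t) − ∫∏W̄_B dμ_(β'))²] ≤ 16S²/((1−12|β'|)#B) + (4√6·π·S·√(#S/#B)·e^(−(1−12|β'|)t))²`. [cite: BakryGentilLedoux2014, Thm 4.7.2 (ii), Thm 3.3.18] -/
theorem wilson_solution_blockLoopString_sqDev_gibbsMean_le_uniform (L : ℕ) [NeZero L] (β' : ℝ) (hβ : |β'| < 1 / 12)
    (m : ℕ) (i j : Fin m → Fin 3) (R T : Fin m → ℕ) (B : Finset (Site 3 L)) (hB : B.Nonempty)
    (t : ℝ≥0) (x₀ : (GaugeConfig 3 L (Matrix.specialUnitaryGroup (Fin 2) ℂ)))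
    (Ω : Type) [MeasurableSpace Ω] (P : Measure Ω) [IsProbabilityMeasure P]
    (W : ℝ≥0 → Ω → (Edge 3 L × NoiseIdx 2 → ℝ)) (hW : IsFlatBrownian W P)
    (U : ℝ≥0 → Ω → (GaugeConfig 3 L (Matrix.specialUnitaryGroup (Fin 2) ℂ))) (hU0 : ∀ ω, U 0 ω = x₀)
    (hU : (latticeLangevinDynamics (fundamentalLatticeRep 2) β').IsSolution (fundamentalRep (Fin 2)) hW.natFiltration P W U) :
    ∫ ω, ((∏ k : Fin m, (((B.card : ℝ))⁻¹ * ∑ x ∈ B, wilsonLoop (fundamentalRep (Fin 2)) x (i k) (j k) (R k) (T k) (U t ω))) - (∫ V, (∏ k : Fin m, (((B.card : ℝ))⁻¹ * ∑ x ∈ B, wilsonLoop (fundamentalRep (Fin 2)) x (i k) (j k) (R k) (T k) V)) ∂(wilsonMeasure (d := 3) (L := L) (fundamentalRep (Fin 2)) β'))) ^ 2 ∂P ≤ 16 * (∑ k : Fin m, ((R k : ℝ) + T k)) ^ 2 / ((1 - 12 * |β'|) * (B.card : ℝ)) + (4 * Real.sqrt 6 * Real.pi * (∑ k : Fin m, ((R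 k : ℝ) + T k)) * Real.sqrt ((Fintype.card (Site 3 L) : ℝ) / (B.card : ℝ)) * Real.exp (-((1 - 12 * |β'|) * (t : ℝ)))) ^ 2 := by
  classical
  haveI := secondCountableTopology_su2
  haveI := borelSpace_config L
  have hvar := wilson_solution_blockLoopString_variance_le_uniform L β' hβ m i j R T B hB t x₀ Ω P W hW U hU0 hU
  have hmean := wilson_solution_blockLoopString_pointwise_mixing_uniform L β' hβ m i j R T B hB t x₀ Ω P W hW U hU0 hU
  obtain ⟨hcont, hbd⟩ := continuous_and_abs_le_one_blockLoopString m i j R T B hB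
  have hmU : Measurable (U t) := (hU.adapted t).mono (hW.natFiltration.le t) le_rfl
  have hXm : AEStronglyMeasurable (fun ω => (∏ k : Fin m, (((B.card : ℝ))⁻¹ * ∑ x ∈ B, wilsonLoop (fundamentalRep (Fin 2)) x (i k) (j k) (R k) (T k) (U t ω)))) P := (hcont.measurable.comp hmU).aestronglyMeasurable
  have iX : Integrable (fun ω => (∏ k : Fin m, (((B.card : ℝ))⁻¹ * ∑ x ∈ B, wilsonLoop (fundamentalRep (Fin 2)) x (i k) (j k) (R k) (T k) (U t ω)))) P :=
    Integrable.of_bound hXm 1 (ae_of_all _ fun ω => by rw [Real.norm_eq_abs]; exact hbd _)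
  have iXe : Integrable (fun ω => (∏ k : Fin m, (((B.card : ℝ))⁻¹ * ∑ x ∈ B, wilsonLoop (fundamentalRep (Fin 2)) x (i k) (j k) (R k) (T k) (U t ω))) - (∫ ω', (∏ k : Fin m, (((B.card : ℝ))⁻¹ * ∑ x ∈ B, wilsonLoop (fundamentalRep (Fin 2)) x (i k) (j k) (R k) (T k) (U t ω'))) ∂P)) P := iX.sub (integrable_const _)
  have i1 : Integrable (fun ω => ((∏ k : Fin m, (((B.card : ℝ))⁻¹ * ∑ x ∈ B, wilsonLoop (fundamentalRep (Fin 2)) x (i k) (j k) (R k) (T k) (U t ω))) - (∫ ω', (∏ k : Fin m, (((B.card : ℝ))⁻¹ * ∑ x ∈ B, wilsonLoop (fundamentalRep (Fin 2)) x (i k) (j k) (R k) (T k) (U t ω'))) ∂P)) ^ 2) P := by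
    refine Integrable.of_bound (iXe.aestronglyMeasurable.pow 2) ((1 + |(∫ ω', (∏ k : Fin m, (((B.card : ℝ))⁻¹ * ∑ x ∈ B, wilsonLoop (fundamentalRep (Fin 2)) x (i k) (j k) (R k) (T k) (U t ω'))) ∂P)|) ^ 2) (ae_of_all _ fun ω => ?_)
    rw [Real.norm_eq_abs, abs_pow]
    exact pow_le_pow_left₀ (abs_nonneg _) ((abs_sub _ _).trans (add_le_add (hbd _) le_rfl)) 2
  have i2 : Integrable (fun ω => 2 * ((∫ ω', (∏ k : Fin m, (((B.card : ℝ))⁻¹ * ∑ x ∈ B, wilsonLoop (fundamentalRep (Fin 2)) x (i k) (j k) (R k) (T k) (U t ω'))) ∂P) - (∫ V, (∏ k : Fin m, (((B.card : ℝ))⁻¹ * ∑ x ∈ B, wilsonLoop (fundamentalRep (Fin 2)) x (i k) (j k) (R k) (T k) V)) ∂(wilsonMeasure (d := 3) (L := L) (fundamentalRep (Fin 2)) β'))) * ((∏ k : Fin m, (((B.card : ℝ))⁻¹ * ∑ x ∈ B, wilsonLoop (fundamentalRep (Fin 2)) x (i k) (j k) (R k) (T k) (U t ω))) - (∫ ω',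 (∏ k : Fin m, (((B.card : ℝ))⁻¹ * ∑ x ∈ B, wilsonLoop (fundamentalRep (Fin 2)) x (i k) (j k) (R k) (T k) (U t ω'))) ∂P))) P := iXe.const_mul _
  have i3 : Integrable (fun ω => 2 * ((∫ ω', (∏ k : Fin m, (((B.card : ℝ))⁻¹ * ∑ x ∈ B, wilsonLoop (fundamentalRep (Fin 2)) x (i k) (j k) (R k) (T k) (U t ω'))) ∂P) - (∫ V, (∏ k : Fin m, (((B.card : ℝ))⁻¹ * ∑ x ∈ B, wilsonLoop (fundamentalRep (Fin 2)) x (i k) (j k) (R k) (T k) V)) ∂(wilsonMeasure (d := 3) (L := L) (fundamentalRep (Fin 2)) β'))) * ((∏ k : Fin m, (((B.card : ℝ))⁻¹ * ∑ x ∈ B, wilsonLoop (fundamentalRep (Fin 2)) x (i k) (j k) (R k) (T k) (U t ω))) - (∫ ω', (∏ k : Fin m, (((B.card : ℝ))⁻¹ * ∑ x ∈ B, wilsonLoop (fundamentalRep (Fin 2)) x (i k) (j k) (R k) (T k) (U t ω'))) ∂P)) + ((∫ ω', (∏ k : Fin m, (((B.card : ℝ))⁻¹ * ∑ x ∈ B,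 wilsonLoop (fundamentalRep (Fin 2)) x (i k) (j k) (R k) (T k) (U t ω'))) ∂P) - (∫ V, (∏ k : Fin m, (((B.card : ℝ))⁻¹ * ∑ x ∈ B, wilsonLoop (fundamentalRep (Fin 2)) x (i k) (j k) (R k) (T k) V)) ∂(wilsonMeasure (d := 3) (L := L) (fundamentalRep (Fin 2)) β'))) ^ 2) P := i2.add (integrable_const _)
  have hpt : ∀ ω, ((∏ k : Fin m, (((B.card : ℝ))⁻¹ * ∑ x ∈ B, wilsonLoop (fundamentalRep (Fin 2)) x (i k) (j k) (R k) (T k) (U t ω))) - (∫ V, (∏ k : Fin m, (((B.card : ℝ))⁻¹ * ∑ x ∈ B, wilsonLoop (fundamentalRep (Fin 2)) x (i k) (j k) (R k) (T k) V)) ∂(wilsonMeasure (d := 3) (L := L) (fundamentalRep (Fin 2)) β'))) ^ 2 =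
      ((∏ k : Fin m, (((B.card : ℝ))⁻¹ * ∑ x ∈ B, wilsonLoop (fundamentalRep (Fin 2)) x (i k) (j k) (R k) (T k) (U t ω))) - (∫ ω', (∏ k : Fin m, (((B.card : ℝ))⁻¹ * ∑ x ∈ B, wilsonLoop (fundamentalRep (Fin 2)) x (i k) (j k) (R k) (T k) (U t ω'))) ∂P)) ^ 2 + (2 * ((∫ ω', (∏ k : Fin m, (((B.card : ℝ))⁻¹ * ∑ x ∈ B, wilsonLoop (fundamentalRep (Fin 2)) x (i k) (j k) (R k) (T k) (U t ω'))) ∂P) - (∫ V, (∏ k : Fin m, (((B.card : ℝ))⁻¹ * ∑ x ∈ B, wilsonLoop (fundamentalRep (Fin 2)) x (i k) (j k) (R k) (T k) V)) ∂(wilsonMeasure (d := 3) (L := L) (fundamentalRep (Fin 2)) β'))) * ((∏ k : Fin m, (((B.card : ℝ))⁻¹ * ∑ x ∈ B, wilsonLoop (fundamentalRep (Fin 2)) x (i k) (j k) (R k) (T k) (U t ω))) - (∫ ω', (∏ k : Fin m, (((B.card : ℝ))⁻¹ * ∑ x ∈ B, wilsonLoop (fundamentalRep (Fin 2)) x (i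 k) (j k) (R k) (T k) (U t ω'))) ∂P)) + ((∫ ω', (∏ k : Fin m, (((B.card : ℝ))⁻¹ * ∑ x ∈ B, wilsonLoop (fundamentalRep (Fin 2)) x (i k) (j k) (R k) (T k) (U t ω'))) ∂P) - (∫ V, (∏ k : Fin m, (((B.card : ℝ))⁻¹ * ∑ x ∈ B, wilsonLoop (fundamentalRep (Fin 2)) x (i k) (j k) (R k) (T k) V)) ∂(wilsonMeasure (d := 3) (L := L) (fundamentalRep (Fin 2)) β'))) ^ 2) := fun ω => by ring
  have hzero : ∫ ω, ((∏ k : Fin m, (((B.card : ℝ))⁻¹ * ∑ x ∈ B, wilsonLoop (fundamentalRep (Fin 2)) x (i k) (j k) (R k) (T k) (U t ω))) - (∫ ω', (∏ k : Fin m, (((B.card : ℝ))⁻¹ * ∑ x ∈ B, wilsonLoop (fundamentalRep (Fin 2)) x (i k) (j k) (R k) (T k) (U t ω'))) ∂P)) ∂P = 0 := by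
    rw [integral_sub iX (integrable_const _), integral_const]
    simp only [probReal_univ, smul_eq_mul, one_mul, sub_self]
  rw [integral_congr_ae (ae_of_all _ hpt), integral_add i1 i3, integral_add i2 (integrable_const _), integral_const_mul, hzero, integral_const]
  simp only [probReal_univ, smul_eq_mul, one_mul, mul_zero, zero_add]
  have hb : ((∫ ω', (∏ k : Fin m, (((B.card : ℝ))⁻¹ * ∑ x ∈ B, wilsonLoop (fundamentalRep (Fin 2)) x (i k) (j k) (R k) (T k) (U t ω'))) ∂P) - (∫ V, (∏ k : Fin m, (((B.card : ℝ))⁻¹ * ∑ x ∈ B, wilsonLoop (fundamentalRep (Fin 2)) x (i k) (j k) (R k) (T k) V)) ∂(wilsonMeasure (d := 3) (L := L) (fundamentalRep (Fin 2)) β'))) ^ 2 ≤ (4 * Real.sqrt 6 * Real.pi * (∑ k : Fin m, ((R k : ℝ) + T k)) * Real.sqrt ((Fintype.card (Site 3 L) : ℝ) / (B.card : ℝ)) * Real.exp (-((1 - 12 * |β'|) * (t : ℝ)))) ^ 2 := by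
    rw [← sq_abs]; exact pow_le_pow_left₀ (abs_nonneg _) hmean 2
  exact add_le_add hvar hb

/-- ★★★ **Chebyshev tail of block loop strings about their Gibbs mean along every SZZ solution.**  At `|β'| < 1/12`, for every `L`, nonempty
`B`, loop data, every strong solution from a deterministic start (e.g. COLD), every `t ≥ 0` and `r > 0`:
`P(|∏W̄_B(U_t) − ∫∏W̄_B dμ_(β')| ≥ r) ≤ (16S²/((1−12|β'|)#B) + (4√6·π·S·√(#S/#B)·e^(−(1−12|β'|)t))²)/r²`.
[cite: BakryGentilLedoux2014, Thm 4.7.2 (ii), Thm 3.3.18] -/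
theorem wilson_solution_blockLoopString_tail_gibbsMean_le_uniform (L : ℕ) [NeZero L] (β' : ℝ) (hβ : |β'| < 1 / 12)
    (m : ℕ) (i j : Fin m → Fin 3) (R T : Fin m → ℕ) (B : Finset (Site 3 L)) (hB : B.Nonempty)
    (t : ℝ≥0) (x₀ : (GaugeConfig 3 L (Matrix.specialUnitaryGroup (Fin 2) ℂ)))
    (Ω : Type) [MeasurableSpace Ω] (P : Measure Ω) [IsProbabilityMeasure P]
    (W : ℝ≥0 → Ω → (Edge 3 L × NoiseIdx 2 → ℝ)) (hW : IsFlatBrownian W P)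
    (U : ℝ≥0 → Ω → (GaugeConfig 3 L (Matrix.specialUnitaryGroup (Fin 2) ℂ))) (hU0 : ∀ ω, U 0 ω = x₀)
    (hU : (latticeLangevinDynamics (fundamentalLatticeRep 2) β').IsSolution (fundamentalRep (Fin 2)) hW.natFiltration P W U) {r : ℝ} (hr : 0 < r) :
    P.real {ω | r ≤ |(∏ k : Fin m, (((B.card : ℝ))⁻¹ * ∑ x ∈ B, wilsonLoop (fundamentalRep (Fin 2)) x (i k) (j k) (R k) (T k) (U t ω))) - (∫ V, (∏ k : Fin m, (((B.card : ℝ))⁻¹ * ∑ x ∈ B, wilsonLoop (fundamentalRep (Fin 2)) x (i k) (j k) (R k) (T k) V)) ∂(wilsonMeasure (d := 3) (L := L) (fundamentalRep (Fin 2)) β'))|} ≤ (16 * (∑ k : Fin m, ((R k : ℝ) + T k)) ^ 2 / ((1 - 12 * |β'|) * (B.card : ℝ)) + (4 * Real.sqrt 6 * Real.pi * (∑ k : Fin m, ((R k : ℝ) + T k)) * Real.sqrt ((Fintype.card (Site 3 L) : ℝ) / (B.card : ℝ)) * Real.exp (-((1 - 12 * |β'|) * (t : ℝ)))) ^ 2)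 / r ^ 2 := by
  classical
  haveI := secondCountableTopology_su2
  haveI := borelSpace_config L
  have hsq := wilson_solution_blockLoopString_sqDev_gibbsMean_le_uniform L β' hβ m i j R T B hB t x₀ Ω P W hW U hU0 hU
  obtain ⟨hcont, hbd⟩ := continuous_and_abs_le_one_blockLoopString m i j R T B hB
  have hmU : Measurable (U t) := (hU.adapted t).mono (hW.natFiltration.le t) le_rfl
  have hXm : AEStronglyMeasurable (fun ω => (∏ k : Fin m, (((B.card : ℝ))⁻¹ * ∑ x ∈ B, wilsonLoop (fundamentalRep (Fin 2)) x (i k) (j k) (R k) (T k) (U t ω)))) P := (hcont.measurable.comp hmU).aestronglyMeasurable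
  have iXm : Integrable (fun ω => (∏ k : Fin m, (((B.card : ℝ))⁻¹ * ∑ x ∈ B, wilsonLoop (fundamentalRep (Fin 2)) x (i k) (j k) (R k) (T k) (U t ω))) - (∫ V, (∏ k : Fin m, (((B.card : ℝ))⁻¹ * ∑ x ∈ B, wilsonLoop (fundamentalRep (Fin 2)) x (i k) (j k) (R k) (T k) V)) ∂(wilsonMeasure (d := 3) (L := L) (fundamentalRep (Fin 2)) β'))) P :=
    (Integrable.of_bound hXm 1 (ae_of_all _ fun ω => by rw [Real.norm_eq_abs]; exact hbd _)).sub (integrable_const _)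
  have i1 : Integrable (fun ω => ((∏ k : Fin m, (((B.card : ℝ))⁻¹ * ∑ x ∈ B, wilsonLoop (fundamentalRep (Fin 2)) x (i k) (j k) (R k) (T k) (U t ω))) - (∫ V, (∏ k : Fin m, (((B.card : ℝ))⁻¹ * ∑ x ∈ B, wilsonLoop (fundamentalRep (Fin 2)) x (i k) (j k) (R k) (T k) V)) ∂(wilsonMeasure (d := 3) (L := L) (fundamentalRep (Fin 2)) β'))) ^ 2) P := by
    refine Integrable.of_bound (iXm.aestronglyMeasurable.pow 2) ((1 + |(∫ V, (∏ k : Fin m, (((B.card : ℝ))⁻¹ * ∑ x ∈ B, wilsonLoop (fundamentalRep (Fin 2)) x (i k) (j k) (R k) (T k) V)) ∂(wilsonMeasure (d := 3) (L := L) (fundamentalRep (Fin 2)) β'))|) ^ 2) (ae_of_all _ fun ω => ?_)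
    rw [Real.norm_eq_abs, abs_pow]
    exact pow_le_pow_left₀ (abs_nonneg _) ((abs_sub _ _).trans (add_le_add (hbd _) le_rfl)) 2
  have hM := mul_meas_ge_le_integral_of_nonneg (μ := P) (ae_of_all _ fun ω => sq_nonneg ((∏ k : Fin m, (((B.card : ℝ))⁻¹ * ∑ x ∈ B, wilsonLoop (fundamentalRep (Fin 2)) x (i k) (j k) (R k) (T k) (U t ω))) - (∫ V, (∏ k : Fin m, (((B.card : ℝ))⁻¹ * ∑ x ∈ B, wilsonLoop (fundamentalRep (Fin 2)) x (i k) (j k) (R k) (T k) V)) ∂(wilsonMeasure (d := 3) (L := L) (fundamentalRep (Fin 2)) β')))) i1 (r ^ 2)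
  have hsub : {ω | r ≤ |(∏ k : Fin m, (((B.card : ℝ))⁻¹ * ∑ x ∈ B, wilsonLoop (fundamentalRep (Fin 2)) x (i k) (j k) (R k) (T k) (U t ω))) - (∫ V, (∏ k : Fin m, (((B.card : ℝ))⁻¹ * ∑ x ∈ B, wilsonLoop (fundamentalRep (Fin 2)) x (i k) (j k) (R k) (T k) V)) ∂(wilsonMeasure (d := 3) (L := L) (fundamentalRep (Fin 2)) β'))|} ⊆ {ω | r ^ 2 ≤ ((∏ k : Fin m, (((B.card : ℝ))⁻¹ * ∑ x ∈ B, wilsonLoop (fundamentalRep (Fin 2)) x (i k) (j k) (R k) (T k) (U t ω))) - (∫ V, (∏ k : Fin m, (((B.card : ℝ))⁻¹ * ∑ x ∈ B, wilsonLoop (fundamentalRep (Fin 2)) x (i k) (j k) (R k) (T k) V)) ∂(wilsonMeasure (d := 3) (L := L) (fundamentalRep (Fin 2)) β'))) ^ 2} := fun ω hω => by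
    simp only [Set.mem_setOf_eq] at hω ⊢
    exact (pow_le_pow_left₀ hr.le hω 2).trans_eq (sq_abs _)
  rw [le_div_iff₀ (pow_pos hr 2), mul_comm]
  exact (mul_le_mul_of_nonneg_left (measureReal_mono hsub) (pow_pos hr 2).le).trans (hM.trans hsq)

/-- ★★ **Chebyshev tail of block loop strings about their Gibbs mean at the route's cut-offs, inside the window `γε_K > 6`** (`#S = L_K³`):
for every cut-off `K` with `6 < γε_K`, nonempty block `B`, loop data, every strong solution at `β'_K` from a deterministic start (e.g. COLD),
every lattice time `t` and `r > 0`: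
`P(|∏W̄_B(U_t) − ∫∏W̄_B dμ_K| ≥ r) ≤ (16S²/((1 − 6/(γε_K))#B) + (4√6·π·S·√(L_K³/#B)·e^(−(1−6/(γε_K))t))²)/r²`.  (Window-bound, NOT `K`-uniform.)
[cite: BakryGentilLedoux2014, Thm 4.7.2 (ii), Thm 3.3.18] -/
theorem blockLoopString_tail_gibbsMean_fixedCutoff_window (F : T3ContinuumYM3Torus.T3Family) (γ : ℝ) (K : ℕ) (hK : 6 < γ * (F.P K).eps)
    (m : ℕ) (i j : Fin m → Fin 3) (R T : Fin m → ℕ) (B : Finset (Site 3 ((F.P K).sitesPerDir 0))) (hB : B.Nonempty)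
    (t : ℝ≥0) (x₀ : GaugeConfig 3 ((F.P K).sitesPerDir 0) (Matrix.specialUnitaryGroup (Fin 2) ℂ))
    (Ω : Type) [MeasurableSpace Ω] (P : Measure Ω) [IsProbabilityMeasure P]
    (W : ℝ≥0 → Ω → (Edge 3 ((F.P K).sitesPerDir 0) × NoiseIdx 2 → ℝ)) (hW : IsFlatBrownian W P)
    (U : ℝ≥0 → Ω → GaugeConfig 3 ((F.P K).sitesPerDir 0) (Matrix.specialUnitaryGroup (Fin 2) ℂ)) (hU0 : ∀ ω, U 0 ω = x₀)
    (hU : (latticeLangevinDynamics (fundamentalLatticeRep 2) ((γ * (F.P K).eps)⁻¹ / 2)).IsSolution (fundamentalRep (Fin 2)) hW.natFiltration P W U) {r : ℝ} (hr : 0 < r) :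
    P.real {ω | r ≤ |(∏ k : Fin m, (((B.card : ℝ))⁻¹ * ∑ x ∈ B, wilsonLoop (fundamentalRep (Fin 2)) x (i k) (j k) (R k) (T k) (U t ω))) - (∫ V, (∏ k : Fin m, (((B.card : ℝ))⁻¹ * ∑ x ∈ B, wilsonLoop (fundamentalRep (Fin 2)) x (i k) (j k) (R k) (T k) V)) ∂(wilsonMeasure (d := 3) (L := ((F.P K).sitesPerDir 0)) (fundamentalRep (Fin 2)) ((γ * (F.P K).eps)⁻¹ / 2)))|} ≤ (16 * (∑ k : Fin m, ((R k : ℝ) + T k)) ^ 2 / ((1 - 6 / (γ * (F.P K).eps)) * (B.card : ℝ)) + (4 * Real.sqrt 6 * Real.pi * (∑ k : Fin m, ((R k : ℝ) + T k)) * Real.sqrt (((((((F.P K).sitesPerDir 0) : ℕ) : ℝ)) ^ 3) / (B.card : ℝ)) * Real.exp (-((1 - 6 / (γ * (F.P K).eps)) * (t : ℝ)))) ^ 2) / r ^ 2 := by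
  obtain ⟨hβ, hrate⟩ := window_coupling_bounds F γ K hK
  have h := wilson_solution_blockLoopString_tail_gibbsMean_le_uniform ((F.P K).sitesPerDir 0) ((γ * (F.P K).eps)⁻¹ / 2) hβ m i j R T B hB t x₀ Ω P W hW U hU0 hU hr
  rw [(card_site_plaquette_fixedCutoff F K).1, hrate] at h
  exact h

end Summit.QuantumFields.YangMills.Theorems.ColdStartUniversality
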